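import Mathlib
import Literature.NumberTheory.LFunctions.Zhang2022.SkeletonPartThree
import HarnessLib

/-!
# Zhang (2022), typed statements: §7 part (b) — proof of Proposition 7.1, "initial steps"
# continued: the Gauss-sum reduction (7.6)–(7.11)

Campaign slice `L2-t3` (plan/L2/ASSIGNMENTS.md v1, row 3): Y. Zhang, *Discrete mean estimates and
the Landau–Siegel zero*, arXiv:2211.02515v1 (2022) [Zhang2022LandauSiegel], §7 "Mean-value formula
I", tex lines L1912–L1982 of the source, PDF pp. 35–37. **An unrefereed manuscript under
adjudication. STATEMENT-ONLY: every `def … : Prop` below is a CLAIM OF THE MANUSCRIPT (or of its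
proof), STATED NOT ASSERTED; typed ≠ discharged. WHAT THIS IS NOT: any claim about Theorems 1–2 of
the manuscript or about Landau–Siegel zeros.**

DAG nodes typed here (ids of `plan/DAG.tsv`, one declaration each; the first token of every
docstring is the node id):

| node | decl | kind | printed item |
|---|---|---|---|
| `Z22:(7.6)` | `Eq76` | CLAIM | `Θ₁ = −iΣ_{p∼P}(pt₀)^{β₃}Σ*_{ψ (mod p)} I₁(ψ) + o(𝔓)` |
| `Z22:§7.u020` | `I1psi` | OBJECT | `I₁(ψ) = (1/2πi)∫_{𝒥(1)} Z(s,ψ)⁻¹(Σ_m(κ∗a₁)(m)ψ(m)m^{−s})A(𝐚₂;1−s,ψ̄)ω(s)ds` |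
| `Z22:§7.u021` | `I1line`, `Step7u021` | OBJECT+CLAIM | `Z(s,ψ)⁻¹ ↦ τ(ψ̄)p^{s−1}ϑ*(1−s)`, `𝒥(1) ↦ (3/2)`, "negligible errors" |
| `Z22:§7.u022` | `I1termwise`, `Step7u022` | OBJECT+CLAIM | `I₁(ψ) = (τ(ψ̄)/p)ΣΣ(κ∗a₁)(m)a₂(n)ψ(m)ψ̄(n)n⁻¹Δ₁(m/pn) + O(ε)` |
| `Z22:§7.u023` | `rhs7u023`, `Step7u023` | OBJECT+CLAIM | `Σ*_ψ I₁(ψ) = p⁻¹ΣΣ(κ∗a₁)(m)a₂(n)n⁻¹Δ₁(m/pn)(Σ*_ψ τ(ψ̄)ψ(m)ψ̄(n)) + O(ε)` |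
| `Z22:§7.u024` | `rhs7u024`, `Step7u024` | OBJECT+CLAIM | the substitution `d = (m,n)`, `m = dl`, `n = dk` |
| `Z22:§7.u025` | `tauTwist`, `Step7u025` | OBJECT+CLAIM | `Σ*_ψ τ(ψ̄)ψ(l)ψ̄(k) = pe(lk̄/p) + O(1)` |
| `Z22:(7.7)` | `rhs77`, `Eq77` | OBJECT+CLAIM | `Σ*_ψ I(ψ) = Σ_d d⁻¹Σ_{(l,p)=1}Σ_{(k,l)=1}(κ∗a₁)(dl)b(dk)k⁻¹e(lk̄/p)Δ₁(l/pk) + O(PT⁻ᶜ)` |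
| (tex L1944, no DAG id) | `rhs77all`, `Step7t1944` | OBJECT+CLAIM | "this remains valid if the constraint `(l,p)=1` is removed" |
| `Z22:§7.u026` | `Step7u026` | CLAIM | `k̄/p ≡ −p̄/k + 1/(pk) (mod 1)` |
| `Z22:§7.u027` | `Step7u027` | CLAIM | `e(lk̄/p)Δ₁(l/pk) = e(−lp̄/k)Δ(l/pk)` |
| `Z22:(7.8)` | `rhs78`, `Eq78` | OBJECT+CLAIM | the right side of (7.7) `= Σ_d d⁻¹Σ_lΣ_{(k,l)=1}(κ∗a₁)(dl)b(dk)k⁻¹e(−lp̄/k)Δ(l/pk) + O(PT⁻ᶜ)` |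
| `Z22:§7.u028` | `nonprincTwist`, `Step7u028` | OBJECT+CLAIM | `e(−lp̄/k) = μ(k)/φ(k) + φ(k)⁻¹Σ′_{θ (mod k)} τ(θ̄)θ(l)θ̄(−p)` |
| `Z22:(7.9)` | `Eq79` | CLAIM | `Σ*_ψ I(ψ) = 𝒯₁₁(p) + 𝒯₁₂(p) + O(PT⁻ᶜ)` |
| `Z22:§7.u029` | `frakT11` | OBJECT | `𝒯₁₁(p)` |
| `Z22:§7.u030` | `frakT12` | OBJECT | `𝒯₁₂(p)` (DAG kind `step`; it is a definition) |
| (tex L1972, no DAG id) | `Step7t1972` | CLAIM | "`(pt₀)^{β₃} = −1 + O(α₁)`" |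
| (tex L1972, no DAG id) | `DedProp71red` | CLAIM(proof) | "By (7.6) and (7.9), the proof of Proposition 7.1 is reduced to showing (7.10) … and (7.11)" |
| `Z22:(7.10)` | `Eq710` | CLAIM | `i𝒯₁₁(p) = (p/α)(½S₁ + 2S₂ + 3/2S₃) + O(P𝓛²Σ_j|S_j|) + o(P)`, `p ∼ P` |
| `Z22:(7.11)` | `Eq711` | CLAIM | `Σ_{p∼P} p^{β₃}𝒯₁₂(p) = o(𝔓)` |

Conventions (skel/INTERFACE.md §3, plan/L2/ASSIGNMENTS.md §A.3). The standing quantifier is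
`Skeleton.ForAllLarge` ("`D` sufficiently large", real primitive `χ (mod D)`), with Assumption (A)
as an antecedent for every claim that lives inside the proof of Proposition 7.1 (as in the banked
`Skeleton.Prop71`); "`X = Y + o(𝔓)`" ↦ `∀ ε > 0, ForAllLarge (… ‖X − Y‖ ≤ ε𝔓)`; "`O(ε)`",
`ε = exp{−c𝓛¹⁰}` (tex L1062) ↦ `∃ c > 0, ∃ C, … ≤ C·exp(−c𝓛¹⁰)`; "`O(PT⁻ᶜ)`" ↦
`∃ c > 0, ∃ C, … ≤ C·P·T⁻ᶜ`; the sequences `𝐚₁, 𝐚₂` satisfy (7.2) in the banked form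
`Skeleton.Adm72 D B a` with an explicit bound `B`, and implied constants may depend on `B`; the
constant `c′` of (2.13) (through `β₃` and `κ`) is the explicit parameter `(c' : ℝ)`. The prime
window `p ∼ P` is `Skeleton.primeWindow D`, `𝔓 = frakP D`; the family `Ψ` is the type
`Skeleton.Chr D`, so "`Σ*_{ψ (mod p)}`" for `p ∼ P` (all primitive `ψ (mod p)`) is the sum over
the members of `Ψ` with modulus `p` (`sumPrimAt`). Series "`Σ_m`" of the source (= `Σ_{m=1}^∞`,
§2 p. 3) are `tsum`s / `LSeries`; the `n`-, `d`-, `k`-sums are cut at `⌈PT⁻²⌉ = Skeleton.Nsupp D`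
where `a₂ = 0` by (7.2), exactly as in the banked `Skeleton.Sj`. Printed-symbol notes recorded in
the docstrings, not silently corrected: (7.7)–(7.9) print `I(ψ)` for the `I₁(ψ)` of (7.6) and
`b(dk)` for `a₂(dk)` (no `b` is defined in §7; `𝒯₁₁`, `𝒯₁₂` three lines later print `a₂(dk)`);
"By (2.4)" at tex L1920 uses the `Z⁻¹` form (2.5) with `ϑ*` of (5.5); `α₁` (tex L1972) is
undefined in v1 and is read as `α𝓛` (the banked `Skeleton.Lemma151` makes the same reading).

Banked declarations CITED (never restated): `Skeleton.Theta1`, `Skeleton.Prop71`, `Skeleton.Ded71`,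
`Skeleton.Sj`, `Skeleton.Adm72`, `Skeleton.Nsupp`, `Skeleton.ApolyBar`, `Skeleton.kappaZ`,
`Skeleton.omegaW`, `Skeleton.DeltaW` (= `Δ` of (5.7)), `Skeleton.beta3/alpha/ell/ell1/ell2/t0/
bigP/bigT/primeWindow/Chr/finsetOf`, `frakP`, `Lemma81.segInt` (`(1/2πi)∫_{𝒥(z)}`),
`Lemma81.dirPoly`, `GammaFactor.Zfac`, `GammaFactor.tau` (`τ(θ)`), `GammaFactor.varthetaStarOneSub`
(`ϑ*(1−s)` of (5.5)), `Lemma53.Delta1_56` (`Δ₁` of (5.6)). Interface stub (plan/L2/ASSIGNMENTS.md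
§D): `Iface.Delta1W` = `Δ₁` at the manuscript's parameters (owner: the L1 §5a typer). Objects
OWNED here and consumed by slices L2-t4/L2-t5: `I1psi`, `frakT11`, `frakT12` (and `sumPrimAt`,
`tauTwist`, `nonprincTwist`, `kappaConv`).

## References

* Y. Zhang, arXiv:2211.02515v1 (2022), §7, proof of Proposition 7.1 ("Initial steps"), (7.6)–(7.11),
  PDF pp. 35–37, tex L1912–L1982; notation §2 p. 3 (`τ(θ)`, `Σ′`, `Σ*`, `e(s)`), (2.4)–(2.5) p. 4,
  (5.5)–(5.7) p. 26, (7.1)–(7.2) p. 32. [cite: Zhang2022LandauSiegel, §7 (7.6)–(7.11) pp. 35–37]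
-/

noncomputable section

open Complex Real

namespace Literature.NumberTheory.LFunctions.Zhang2022.Section7bStatements

/-! ## Interface stub (object owned by another slice) -/

namespace Iface

/-- `Z22:(5.6)` IFACE-STUB (object owned by the L1 §5a typer, tex L1393; TODO-merge): **`Δ₁(x)`** of
(5.6), `(1/2πi)∫_{(3/2)} x^{−s}ϑ*(1−s)ω(s)ds`, at the manuscript's parameters `𝓛₂ = 𝓛⁴⁰⁰`, `t₀ = 𝓛⁵¹⁹`
— the tree's `Lemma53.Delta1_56` (so that `Skeleton.DeltaW D x = Δ(x) = Δ₁(x)e(x)` of (5.7) is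
`Lemma53.Delta57` at the same parameters). [cite: Zhang2022LandauSiegel, §5 (5.6) p. 26, tex L1393] -/
def Delta1W (D : ℕ) (x : ℝ) : ℂ := Lemma53.Delta1_56 (Skeleton.ell2 D) (Skeleton.t0 D) x

end Iface

/-! ## Objects of tex L1912–L1982 -/

section Objects

variable (c' : ℝ)

/-- `(κ ∗ a₁)(m)` (§7 p. 34, tex L1869–L1871: "regard `a₁` as an arithmetic function"; `∗` = Dirichlet
convolution, §2 p. 3): the convolution of the banked `κ` (`Skeleton.kappaZ c′ D`,
`Σκ(n)n^{−s} = ζ(s+β₁)ζ(s+β₂)ζ(s+β₃)/ζ(s)`) with the sequence `𝐚₁`. An abbreviation, not a node.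
[cite: Zhang2022LandauSiegel, §7 p. 34, tex L1869] -/
def kappaConv (D : ℕ) (a₁ : ℕ → ℂ) : ℕ → ℂ :=
  LSeries.convolution (fun n => Skeleton.kappaZ c' D n) a₁

variable {D : ℕ}

/-- `Z22:§7.u020` OBJECT. **`I₁(ψ) = (1/2πi)∫_{𝒥(1)} Z(s,ψ)⁻¹(Σ_m (κ∗a₁)(m)ψ(m)m^{−s})A(𝐚₂;1−s,ψ̄)ω(s)ds`**
for `ψ (mod p) ∈ Ψ` (tex L1917–L1919), with `𝒥(1) = [s₀+1−i𝓛₁, s₀+1+i𝓛₁]` (the banked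
`Lemma81.segInt … 1`), the `m`-series as an `LSeries` (absolutely convergent on `σ = 3/2`),
`A(𝐚₂;1−s,ψ̄) = Skeleton.ApolyBar`, `ω = Skeleton.omegaW`. OWNED by this slice (consumed by L2-t4/t5).
[cite: Zhang2022LandauSiegel, §7 (7.6) p. 35, tex L1917] -/
def I1psi (x : Skeleton.Chr D) (a₁ a₂ : ℕ → ℂ) : ℂ :=
  Lemma81.segInt (Skeleton.t0 D) (Skeleton.ell1 D) 1 fun s =>
    (GammaFactor.Zfac x.ψ s)⁻¹ *
      LSeries (fun m => kappaConv c' D a₁ m * x.ψ (m : ZMod x.p)) s *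
      Skeleton.ApolyBar x a₂ (1 - s) * Skeleton.omegaW D s

/-- `Z22:§7.u021` OBJECT (the modified integral of tex L1920): **`I₁(ψ)` with `Z(s,ψ)⁻¹` replaced by
`τ(ψ̄)p^{s−1}ϑ*(1−s)` and the segment `𝒥(1)` replaced by the line `σ = 3/2`**:
`(1/2πi)∫_{(3/2)} τ(ψ̄)p^{s−1}ϑ*(1−s)(Σ_m (κ∗a₁)(m)ψ(m)m^{−s})A(𝐚₂;1−s,ψ̄)ω(s)ds`, parametrised
`s = 3/2 + it`, `ds = i dt` (as in the tree's `Lemma53.Delta1_56`); `τ(ψ̄) = GammaFactor.tau ψ⁻¹`,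
`ϑ*(1−s) = GammaFactor.varthetaStarOneSub s` ((5.5), tex L1389).
[cite: Zhang2022LandauSiegel, §7 p. 35, tex L1920] -/
def I1line (x : Skeleton.Chr D) (a₁ a₂ : ℕ → ℂ) : ℂ :=
  1 / (2 * π) * ∫ t : ℝ,
    GammaFactor.tau x.ψ⁻¹ * (x.p : ℂ) ^ (((3 / 2 : ℂ) + t * I) - 1) *
      GammaFactor.varthetaStarOneSub ((3 / 2 : ℂ) + t * I) *
      LSeries (fun m => kappaConv c' D a₁ m * x.ψ (m : ZMod x.p)) ((3 / 2 : ℂ) + t * I) *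
      Skeleton.ApolyBar x a₂ (1 - ((3 / 2 : ℂ) + t * I)) *
      Skeleton.omegaW D ((3 / 2 : ℂ) + t * I)

/-- `Z22:§7.u022` OBJECT (the right side of the display tex L1921–L1924, without its `O(ε)`):
**`(τ(ψ̄)/p) Σ_m Σ_n (κ∗a₁)(m)a₂(n)ψ(m)ψ̄(n) n⁻¹ Δ₁(m/(pn))`** ("integration term-by-term"); the
`m`-series is a `tsum`, the `n`-sum is cut at `⌈PT⁻²⌉` where `a₂ = 0` by (7.2).
[cite: Zhang2022LandauSiegel, §7 p. 35, tex L1921] -/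
def I1termwise (x : Skeleton.Chr D) (a₁ a₂ : ℕ → ℂ) : ℂ :=
  GammaFactor.tau x.ψ⁻¹ / (x.p : ℂ) *
    ∑' m : ℕ, ∑ n ∈ Finset.Ico 1 (Skeleton.Nsupp D),
      kappaConv c' D a₁ m * a₂ n * x.ψ (m : ZMod x.p) * x.ψ⁻¹ (n : ZMod x.p) / (n : ℂ) *
        Iface.Delta1W D ((m : ℝ) / ((x.p : ℝ) * n))

/-- **`Σ*_{ψ (mod p)} f(ψ)`** for a window prime `p ∼ P` (§2 p. 3: "a sum over all primitive
`ψ (mod p)`"): the sum over the members of `Ψ = Skeleton.Chr D` whose modulus is `p` (these are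
exactly the primitive characters mod `p`; a finite set, `Skeleton.finsetOf`). Notation helper,
not a node. [cite: Zhang2022LandauSiegel, §2 p. 3, tex L290–L295] -/
def sumPrimAt (D p : ℕ) (f : Skeleton.Chr D → ℂ) : ℂ :=
  ∑ x ∈ Skeleton.finsetOf {x : Skeleton.Chr D | x.p = p}, f x

/-- `Z22:§7.u025` OBJECT (the character sum of tex L1928–L1937): **`Σ*_{ψ (mod p)} τ(ψ̄)ψ(m)ψ̄(n)`**
for `p ∼ P` (`ψ̄ = ψ⁻¹`, `τ = GammaFactor.tau`). [cite: Zhang2022LandauSiegel, §7 p. 36, tex L1928] -/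
def tauTwist (D p m n : ℕ) : ℂ :=
  sumPrimAt D p fun x => GammaFactor.tau x.ψ⁻¹ * x.ψ (m : ZMod x.p) * x.ψ⁻¹ (n : ZMod x.p)

/-- `Z22:§7.u023` OBJECT (the right side of the display tex L1926–L1929, without its `O(ε)`):
**`p⁻¹ Σ_m Σ_n (κ∗a₁)(m)a₂(n) n⁻¹ Δ₁(m/(pn)) (Σ*_{ψ (mod p)} τ(ψ̄)ψ(m)ψ̄(n))`**.
[cite: Zhang2022LandauSiegel, §7 p. 36, tex L1926] -/
def rhs7u023 (D p : ℕ) (a₁ a₂ : ℕ → ℂ) : ℂ :=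
  1 / (p : ℂ) *
    ∑' m : ℕ, ∑ n ∈ Finset.Ico 1 (Skeleton.Nsupp D),
      kappaConv c' D a₁ m * a₂ n / (n : ℂ) * Iface.Delta1W D ((m : ℝ) / ((p : ℝ) * n)) *
        tauTwist D p m n

/-- `Z22:§7.u024` OBJECT (the display tex L1931–L1934): **`p⁻¹ Σ_d d⁻¹ Σ_l Σ_{(k,l)=1}
(κ∗a₁)(dl)a₂(dk) k⁻¹ (Σ*_{ψ (mod p)} τ(ψ̄)ψ(l)ψ̄(k)) Δ₁(l/(pk))`** ("substituting `d = (m,n)`,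
`m = dl`, `n = dk`"); `l` a series, `d`, `k` cut at `⌈PT⁻²⌉` (`a₂(dk) = 0` beyond).
[cite: Zhang2022LandauSiegel, §7 p. 36, tex L1931] -/
def rhs7u024 (D p : ℕ) (a₁ a₂ : ℕ → ℂ) : ℂ :=
  1 / (p : ℂ) *
    ∑ d ∈ Finset.Ico 1 (Skeleton.Nsupp D), 1 / (d : ℂ) *
      ∑' l : ℕ, ∑ k ∈ (Finset.Ico 1 (Skeleton.Nsupp D)).filter (fun k => Nat.Coprime k l),
        kappaConv c' D a₁ (d * l) * a₂ (d * k) / (k : ℂ) * tauTwist D p l k *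
          Iface.Delta1W D ((l : ℝ) / ((p : ℝ) * k))

/-- `Z22:(7.7)` OBJECT (the right side of (7.7) without its `O(PT⁻ᶜ)`, tex L1940–L1942):
**`Σ_d d⁻¹ Σ_{(l,p)=1} Σ_{(k,l)=1} (κ∗a₁)(dl)a₂(dk) k⁻¹ e(lk̄/p) Δ₁(l/(pk))`**, `k̄k ≡ 1 (mod p)`
(`k̄ = ((k : ZMod p)⁻¹).val`), `e(x) = exp{2πix}`. The source prints `b(dk)`; no `b` is defined in
§7 and the neighbouring displays (tex L1933, L1965) print `a₂(dk)` — typed as `a₂(dk)` (PRINT NOTE).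
[cite: Zhang2022LandauSiegel, §7 (7.7) p. 36, tex L1940] -/
def rhs77 (D p : ℕ) (a₁ a₂ : ℕ → ℂ) : ℂ :=
  ∑ d ∈ Finset.Ico 1 (Skeleton.Nsupp D), 1 / (d : ℂ) *
    ∑' l : ℕ, ∑ k ∈ (Finset.Ico 1 (Skeleton.Nsupp D)).filter (fun k => Nat.Coprime k l),
      if Nat.Coprime l p then
        kappaConv c' D a₁ (d * l) * a₂ (d * k) / (k : ℂ) *
          Complex.exp (2 * π * I * ((l : ℂ) * (((k : ZMod p)⁻¹).val : ℂ) / (p : ℂ))) *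
          Iface.Delta1W D ((l : ℝ) / ((p : ℝ) * k))
      else 0

/-- (tex L1944, sentence between `Z22:(7.7)` and `Z22:§7.u026`; no DAG id) OBJECT: the right side of
(7.7) **with the constraint `(l,p) = 1` removed**. [cite: Zhang2022LandauSiegel, §7 p. 36, tex L1944] -/
def rhs77all (D p : ℕ) (a₁ a₂ : ℕ → ℂ) : ℂ :=
  ∑ d ∈ Finset.Ico 1 (Skeleton.Nsupp D), 1 / (d : ℂ) *
    ∑' l : ℕ, ∑ k ∈ (Finset.Ico 1 (Skeleton.Nsupp D)).filter (fun k => Nat.Coprime k l),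
      kappaConv c' D a₁ (d * l) * a₂ (d * k) / (k : ℂ) *
        Complex.exp (2 * π * I * ((l : ℂ) * (((k : ZMod p)⁻¹).val : ℂ) / (p : ℂ))) *
        Iface.Delta1W D ((l : ℝ) / ((p : ℝ) * k))

/-- `Z22:(7.8)` OBJECT (the right side of (7.8) without its `O(PT⁻ᶜ)`, tex L1953–L1955):
**`Σ_d d⁻¹ Σ_l Σ_{(k,l)=1} (κ∗a₁)(dl)a₂(dk) k⁻¹ e(−lp̄/k) Δ(l/(pk))`**, `p̄p ≡ 1 (mod k)`
(`p̄ = ((p : ZMod k)⁻¹).val`), `Δ = Skeleton.DeltaW` ((5.7)); printed `b(dk)` read `a₂(dk)` as in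
`rhs77`. [cite: Zhang2022LandauSiegel, §7 (7.8) p. 36, tex L1953] -/
def rhs78 (D p : ℕ) (a₁ a₂ : ℕ → ℂ) : ℂ :=
  ∑ d ∈ Finset.Ico 1 (Skeleton.Nsupp D), 1 / (d : ℂ) *
    ∑' l : ℕ, ∑ k ∈ (Finset.Ico 1 (Skeleton.Nsupp D)).filter (fun k => Nat.Coprime k l),
      kappaConv c' D a₁ (d * l) * a₂ (d * k) / (k : ℂ) *
        Complex.exp (2 * π * I * (-((l : ℂ) * (((p : ZMod k)⁻¹).val : ℂ) / (k : ℂ)))) *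
        Skeleton.DeltaW D ((l : ℝ) / ((p : ℝ) * k))

open scoped Classical in
/-- `Z22:§7.u028` OBJECT (the inner sum of tex L1957–L1958 and of `𝒯₁₂`):
**`Σ′_{θ (mod k)} τ(θ̄)θ(l)θ̄(−p)`**, "a sum over all non-principal `θ (mod k)`" (§2 p. 3), `θ̄ = θ⁻¹`.
Defined by cases on `k` (value `0` at the unused modulus `k = 0`) so that it is a plain function
`ℕ → ℂ` of `k`, summable over `k` without instance arguments.
[cite: Zhang2022LandauSiegel, §7 p. 36, tex L1957] -/
def nonprincTwist (l p : ℕ) : ℕ → ℂ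
  | 0 => 0
  | k + 1 =>
    ∑ θ ∈ (Finset.univ : Finset (DirichletCharacter ℂ (k + 1))).filter (fun θ => θ ≠ 1),
      GammaFactor.tau θ⁻¹ * θ (l : ZMod (k + 1)) * θ⁻¹ (-(p : ZMod (k + 1)))

/-- `Z22:§7.u029` OBJECT. **`𝒯₁₁(p) = Σ_d d⁻¹ Σ_l Σ_{(k,l)=1} (κ∗a₁)(dl)a₂(dk)μ(k) (kφ(k))⁻¹ Δ(l/(pk))`**
(tex L1964–L1966); `l` a series (`tsum`), `d`, `k` cut at `⌈PT⁻²⌉` (`a₂(dk) = 0` beyond, (7.2)),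
`Δ = Skeleton.DeltaW`. OWNED by this slice (consumed by L2-t5, (7.16)–(7.21)).
[cite: Zhang2022LandauSiegel, §7 p. 37, tex L1964] -/
def frakT11 (D p : ℕ) (a₁ a₂ : ℕ → ℂ) : ℂ :=
  ∑ d ∈ Finset.Ico 1 (Skeleton.Nsupp D), 1 / (d : ℂ) *
    ∑' l : ℕ, ∑ k ∈ (Finset.Ico 1 (Skeleton.Nsupp D)).filter (fun k => Nat.Coprime k l),
      kappaConv c' D a₁ (d * l) * a₂ (d * k) * (ArithmeticFunction.moebius k : ℂ) /
          ((k : ℂ) * (Nat.totient k : ℂ)) *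
        Skeleton.DeltaW D ((l : ℝ) / ((p : ℝ) * k))

/-- `Z22:§7.u030` OBJECT (DAG kind `step`; the display DEFINES `𝒯₁₂`). **`𝒯₁₂(p) = Σ_d d⁻¹ Σ_l Σ_{(k,l)=1}
(κ∗a₁)(dl)a₂(dk) (kφ(k))⁻¹ (Σ′_{θ (mod k)} τ(θ̄)θ(l)θ̄(−p)) Δ(l/(pk))`** (tex L1968–L1970).
OWNED by this slice (consumed by L2-t4, (7.12)–(7.15)). [cite: Zhang2022LandauSiegel, §7 p. 37, tex L1968] -/
def frakT12 (D p : ℕ) (a₁ a₂ : ℕ → ℂ) : ℂ :=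
  ∑ d ∈ Finset.Ico 1 (Skeleton.Nsupp D), 1 / (d : ℂ) *
    ∑' l : ℕ, ∑ k ∈ (Finset.Ico 1 (Skeleton.Nsupp D)).filter (fun k => Nat.Coprime k l),
      kappaConv c' D a₁ (d * l) * a₂ (d * k) / ((k : ℂ) * (Nat.totient k : ℂ)) *
        nonprincTwist l p k * Skeleton.DeltaW D ((l : ℝ) / ((p : ℝ) * k))

end Objects

/-! ## Claims of tex L1912–L1982 (stated, not asserted) -/

section Claims

variable (c' : ℝ)

/-- `Z22:(7.6)` CLAIM. "By (7.3) we may write **`Θ₁ = −i Σ_{p∼P} (pt₀)^{β₃} Σ*_{ψ (mod p)} I₁(ψ) + o(𝔓)`**"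
(tex L1912–L1915), for `𝐚₁, 𝐚₂` satisfying (7.2); `Θ₁ = Θ₁(𝐚₁,𝐚₂)` is the banked `Skeleton.Theta1`.
Refines `Skeleton.Ded71` (it is the output of part (a) "Initial steps", from (7.3), Prop. 2.1, (2.9)).
[cite: Zhang2022LandauSiegel, §7 (7.6) p. 35, tex L1913] -/
def Eq76 : Prop :=
  ∀ B : ℝ, ∀ ε : ℝ, 0 < ε → Skeleton.ForAllLarge fun D _ χ => Skeleton.AssumptionA D χ →
    ∀ a₁ a₂ : ℕ → ℂ, Skeleton.Adm72 D B a₁ → Skeleton.Adm72 D B a₂ →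
      ‖Skeleton.Theta1 c' χ a₁ a₂ -
          (-I) * ∑ p ∈ Skeleton.primeWindow D,
            (((p : ℝ) * Skeleton.t0 D : ℝ) : ℂ) ^ Skeleton.beta3 c' D *
              sumPrimAt D p (fun x => I1psi c' x a₁ a₂)‖
        ≤ ε * frakP D

/-- `Z22:§7.u021` CLAIM. "Assume `ψ (mod p) ∈ Ψ`. By (2.4), in the integral `I₁(ψ)`, the factor
`Z(s,ψ)⁻¹` can be replaced by `τ(ψ̄)p^{s−1}ϑ*(1−s)`, and then, by a trivial bound for `ϑ*(1−s)ω(s)` on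
`σ = 3/2`, the segment `𝒥(1)` can be replaced by the line `σ = 3/2`, **with negligible errors**"
(tex L1920) — typed as `I₁(ψ) = I1line + O(ε)`, `ε = exp{−c𝓛¹⁰}` (tex L1062). PRINT NOTE: the cited
"(2.4)" is the `Z⁻¹`-form (2.5) combined with (5.5) (`ϑ ↦ ϑ*`).
[cite: Zhang2022LandauSiegel, §7 p. 35, tex L1920] -/
def Step7u021 : Prop :=
  ∀ B : ℝ, ∃ c : ℝ, 0 < c ∧ ∃ C : ℝ, Skeleton.ForAllLarge fun D _ χ => Skeleton.AssumptionA D χ →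
    ∀ a₁ a₂ : ℕ → ℂ, Skeleton.Adm72 D B a₁ → Skeleton.Adm72 D B a₂ → ∀ x : Skeleton.Chr D,
      ‖I1psi c' x a₁ a₂ - I1line c' x a₁ a₂‖ ≤ C * Real.exp (-c * Skeleton.ell D ^ 10)

/-- `Z22:§7.u022` CLAIM. "Thus, integration term-by-term gives
**`I₁(ψ) = (τ(ψ̄)/p) Σ_m Σ_n (κ∗a₁)(m)a₂(n)ψ(m)ψ̄(n) n⁻¹ Δ₁(m/(pn)) + O(ε)`**" (tex L1921–L1924),
`ψ (mod p) ∈ Ψ`. [cite: Zhang2022LandauSiegel, §7 p. 35, tex L1921] -/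
def Step7u022 : Prop :=
  ∀ B : ℝ, ∃ c : ℝ, 0 < c ∧ ∃ C : ℝ, Skeleton.ForAllLarge fun D _ χ => Skeleton.AssumptionA D χ →
    ∀ a₁ a₂ : ℕ → ℂ, Skeleton.Adm72 D B a₁ → Skeleton.Adm72 D B a₂ → ∀ x : Skeleton.Chr D,
      ‖I1psi c' x a₁ a₂ - I1termwise c' x a₁ a₂‖ ≤ C * Real.exp (-c * Skeleton.ell D ^ 10)

/-- `Z22:§7.u023` CLAIM. "This yields **`Σ*_{ψ (mod p)} I₁(ψ) = p⁻¹ Σ_m Σ_n (κ∗a₁)(m)a₂(n) n⁻¹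
Δ₁(m/(pn)) (Σ*_{ψ (mod p)} τ(ψ̄)ψ(m)ψ̄(n)) + O(ε)`**" (tex L1925–L1929), `p ∼ P`.
[cite: Zhang2022LandauSiegel, §7 p. 36, tex L1926] -/
def Step7u023 : Prop :=
  ∀ B : ℝ, ∃ c : ℝ, 0 < c ∧ ∃ C : ℝ, Skeleton.ForAllLarge fun D _ χ => Skeleton.AssumptionA D χ →
    ∀ a₁ a₂ : ℕ → ℂ, Skeleton.Adm72 D B a₁ → Skeleton.Adm72 D B a₂ →
      ∀ p ∈ Skeleton.primeWindow D,
        ‖sumPrimAt D p (fun x => I1psi c' x a₁ a₂) - rhs7u023 c' D p a₁ a₂‖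
          ≤ C * Real.exp (-c * Skeleton.ell D ^ 10)

/-- `Z22:§7.u024` CLAIM. "Note that `(n,p) = 1` if `n < PT⁻²`. On substituting `d = (m,n)`, `m = dl`,
`n = dk`, we find that **the main term on the right side above is
`p⁻¹ Σ_d d⁻¹ Σ_l Σ_{(k,l)=1} (κ∗a₁)(dl)a₂(dk) k⁻¹ (Σ*_{ψ (mod p)} τ(ψ̄)ψ(l)ψ̄(k)) Δ₁(l/(pk))`**"
(tex L1930–L1934): an identity of the two expressions (the rearrangement of the absolutely
convergent double series), for `𝐚₁, 𝐚₂` satisfying (7.2) and `p ∼ P`.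
[cite: Zhang2022LandauSiegel, §7 p. 36, tex L1931] -/
def Step7u024 : Prop :=
  ∀ B : ℝ, Skeleton.ForAllLarge fun D _ _ =>
    ∀ a₁ a₂ : ℕ → ℂ, Skeleton.Adm72 D B a₁ → Skeleton.Adm72 D B a₂ →
      ∀ p ∈ Skeleton.primeWindow D, rhs7u023 c' D p a₁ a₂ = rhs7u024 c' D p a₁ a₂

/-- `Z22:§7.u025` CLAIM. "Since `τ(ψ⁰_p) = −1`, for `(kl,p) = 1` we have
**`Σ*_{ψ (mod p)} τ(ψ̄)ψ(l)ψ̄(k) = p·e(lk̄/p) + O(1)`** with `k̄k ≡ 1 (mod p)`" (tex L1935–L1938), for a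
window prime `p ∼ P` (the context `ψ (mod p) ∈ Ψ`); `e(x) = exp{2πix}`, `k̄ = ((k : ZMod p)⁻¹).val`.
(A standard evaluation — for `p` prime the primitive characters are the non-principal ones and the
full character sum is `(p−1)e(lk̄/p)`; typed as the manuscript's claim, with an absolute `O(1)`.)
[cite: Zhang2022LandauSiegel, §7 p. 36, tex L1936] -/
def Step7u025 : Prop :=
  ∃ C : ℝ, ∀ (D p : ℕ), p ∈ Skeleton.primeWindow D → ∀ k l : ℕ, Nat.Coprime (k * l) p →
    ‖tauTwist D p l k -
        (p : ℂ) * Complex.exp (2 * π * I * ((l : ℂ) * (((k : ZMod p)⁻¹).val : ℂ) / (p : ℂ)))‖ ≤ C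

/-- `Z22:(7.7)` CLAIM. "Hence, by Lemma 5.4, **`Σ*_{ψ (mod p)} I(ψ) = Σ_d d⁻¹ Σ_{(l,p)=1} Σ_{(k,l)=1}
(κ∗a₁)(dl)b(dk) k⁻¹ e(lk̄/p) Δ₁(l/(pk)) + O(PT⁻ᶜ)`**" (tex L1939–L1942), `p ∼ P`, `𝐚₁, 𝐚₂` satisfying
(7.2). PRINT NOTES: `I(ψ)` is the `I₁(ψ)` of (7.6) (no other `I` is defined); `b(dk)` is read
`a₂(dk)` (see `rhs77`). "`O(PT⁻ᶜ)`" with an absolute `c > 0`.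
[cite: Zhang2022LandauSiegel, §7 (7.7) p. 36, tex L1940] -/
def Eq77 : Prop :=
  ∀ B : ℝ, ∃ c : ℝ, 0 < c ∧ ∃ C : ℝ, Skeleton.ForAllLarge fun D _ χ => Skeleton.AssumptionA D χ →
    ∀ a₁ a₂ : ℕ → ℂ, Skeleton.Adm72 D B a₁ → Skeleton.Adm72 D B a₂ →
      ∀ p ∈ Skeleton.primeWindow D,
        ‖sumPrimAt D p (fun x => I1psi c' x a₁ a₂) - rhs77 c' D p a₁ a₂‖
          ≤ C * Skeleton.bigP D * Skeleton.bigT D ^ (-c)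

/-- (tex L1944; no DAG id — sentence between `Z22:(7.7)` and `Z22:§7.u026`) CLAIM. "By trivial
estimation, **this remains valid if the constraint `(l,p) = 1` is removed**": (7.7) with `rhs77all`
in place of `rhs77`. [cite: Zhang2022LandauSiegel, §7 p. 36, tex L1944] -/
def Step7t1944 : Prop :=
  ∀ B : ℝ, ∃ c : ℝ, 0 < c ∧ ∃ C : ℝ, Skeleton.ForAllLarge fun D _ χ => Skeleton.AssumptionA D χ →
    ∀ a₁ a₂ : ℕ → ℂ, Skeleton.Adm72 D B a₁ → Skeleton.Adm72 D B a₂ →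
      ∀ p ∈ Skeleton.primeWindow D,
        ‖sumPrimAt D p (fun x => I1psi c' x a₁ a₂) - rhs77all c' D p a₁ a₂‖
          ≤ C * Skeleton.bigP D * Skeleton.bigT D ^ (-c)

/-- `Z22:§7.u026` CLAIM. "the relation **`k̄/p ≡ −p̄/k + 1/(pk) (mod 1)`**" (tex L1945–L1947), for
coprime `k, p ≥ 1`, `k̄k ≡ 1 (mod p)`, `p̄p ≡ 1 (mod k)` (`k̄ = ((k : ZMod p)⁻¹).val`,
`p̄ = ((p : ZMod k)⁻¹).val`): the two reals differ by an integer. (Exact and standard; stated.)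
[cite: Zhang2022LandauSiegel, §7 p. 36, tex L1945] -/
def Step7u026 : Prop :=
  ∀ p k : ℕ, 0 < p → 0 < k → Nat.Coprime k p →
    ∃ z : ℤ, ((((k : ZMod p)⁻¹).val : ℝ) / p) =
      -((((p : ZMod k)⁻¹).val : ℝ) / k) + 1 / ((p : ℝ) * k) + z

/-- `Z22:§7.u027` CLAIM. "we have **`e(lk̄/p) Δ₁(l/(pk)) = e(−lp̄/k) Δ(l/(pk))`**" (tex L1948–L1951),
`Δ = Δ₁·e` ((5.7), `Skeleton.DeltaW`), for coprime `k, p ≥ 1` and every `l`.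
[cite: Zhang2022LandauSiegel, §7 p. 36, tex L1949] -/
def Step7u027 : Prop :=
  ∀ (D p k l : ℕ), 0 < p → 0 < k → Nat.Coprime k p →
    Complex.exp (2 * π * I * ((l : ℂ) * (((k : ZMod p)⁻¹).val : ℂ) / (p : ℂ))) *
        Iface.Delta1W D ((l : ℝ) / ((p : ℝ) * k)) =
      Complex.exp (2 * π * I * (-((l : ℂ) * (((p : ZMod k)⁻¹).val : ℂ) / (k : ℂ)))) *
        Skeleton.DeltaW D ((l : ℝ) / ((p : ℝ) * k))

/-- `Z22:(7.8)` CLAIM. "Thus **the right side of (7.7) is `Σ_d d⁻¹ Σ_l Σ_{(k,l)=1} (κ∗a₁)(dl)b(dk) k⁻¹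
e(−lp̄/k) Δ(l/(pk)) + O(PT⁻ᶜ)`**" (tex L1952–L1955) — typed as the resulting evaluation of the left
side of (7.7), `Σ*_{ψ (mod p)} I₁(ψ) = rhs78 + O(PT⁻ᶜ)` (which is how (7.9) consumes it), `p ∼ P`,
`𝐚₁, 𝐚₂` satisfying (7.2); `b(dk)` read `a₂(dk)`. [cite: Zhang2022LandauSiegel, §7 (7.8) p. 36, tex L1953] -/
def Eq78 : Prop :=
  ∀ B : ℝ, ∃ c : ℝ, 0 < c ∧ ∃ C : ℝ, Skeleton.ForAllLarge fun D _ χ => Skeleton.AssumptionA D χ →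
    ∀ a₁ a₂ : ℕ → ℂ, Skeleton.Adm72 D B a₁ → Skeleton.Adm72 D B a₂ →
      ∀ p ∈ Skeleton.primeWindow D,
        ‖sumPrimAt D p (fun x => I1psi c' x a₁ a₂) - rhs78 c' D p a₁ a₂‖
          ≤ C * Skeleton.bigP D * Skeleton.bigT D ^ (-c)

/-- `Z22:§7.u028` CLAIM. "For `(l,k) = 1` we have **`e(−lp̄/k) = μ(k)/φ(k) + φ(k)⁻¹ Σ′_{θ (mod k)}
τ(θ̄)θ(l)θ̄(−p)`**" (tex L1956–L1958), `p̄p ≡ 1 (mod k)` (so also `(p,k) = 1`, automatic in context: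
`k < PT⁻² < p`), `k ≥ 1`. (Exact: orthogonality of characters with `τ(θ⁰_k) = μ(k)`; stated.)
[cite: Zhang2022LandauSiegel, §7 p. 36, tex L1957] -/
def Step7u028 : Prop :=
  ∀ k p l : ℕ, 0 < k → Nat.Coprime l k → Nat.Coprime p k →
    Complex.exp (2 * π * I * (-((l : ℂ) * (((p : ZMod k)⁻¹).val : ℂ) / (k : ℂ)))) =
      (ArithmeticFunction.moebius k : ℂ) / (Nat.totient k : ℂ) +
        1 / (Nat.totient k : ℂ) * nonprincTwist l p k

/-- `Z22:(7.9)` CLAIM. "Inserting this into (7.8) we deduce that **`Σ*_{ψ (mod p)} I(ψ) = 𝒯₁₁(p) + 𝒯₁₂(p)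
+ O(PT⁻ᶜ)`**" (tex L1959–L1962), `p ∼ P`, `𝐚₁, 𝐚₂` satisfying (7.2); `I(ψ)` = `I₁(ψ)` of (7.6)
(PRINT NOTE as for (7.7)). [cite: Zhang2022LandauSiegel, §7 (7.9) p. 36, tex L1960] -/
def Eq79 : Prop :=
  ∀ B : ℝ, ∃ c : ℝ, 0 < c ∧ ∃ C : ℝ, Skeleton.ForAllLarge fun D _ χ => Skeleton.AssumptionA D χ →
    ∀ a₁ a₂ : ℕ → ℂ, Skeleton.Adm72 D B a₁ → Skeleton.Adm72 D B a₂ →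
      ∀ p ∈ Skeleton.primeWindow D,
        ‖sumPrimAt D p (fun x => I1psi c' x a₁ a₂) - (frakT11 c' D p a₁ a₂ + frakT12 c' D p a₁ a₂)‖
          ≤ C * Skeleton.bigP D * Skeleton.bigT D ^ (-c)

/-- (tex L1972; no DAG id — first sentence after `Z22:§7.u030`) CLAIM. "Note that
**`(pt₀)^{β₃} = −1 + O(α₁)`**", `p ∼ P`. AMBIGUITY: `α₁` is not defined anywhere in arXiv:2211.02515v1;
read as `α𝓛` (`Skeleton.alpha D * Skeleton.ell D`), the reading used by the banked
`Skeleton.Lemma151` and consistent with every use of `α₁` in the source (alternative reading: any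
fixed positive power of `𝓛` times `α` would serve the same purpose at this point).
[cite: Zhang2022LandauSiegel, §7 p. 37, tex L1972] -/
def Step7t1972 : Prop :=
  ∃ C : ℝ, Skeleton.ForAllLarge fun D _ _ => ∀ p ∈ Skeleton.primeWindow D,
    ‖(((p : ℝ) * Skeleton.t0 D : ℝ) : ℂ) ^ Skeleton.beta3 c' D + 1‖
      ≤ C * (Skeleton.alpha D * Skeleton.ell D)

/-- `Z22:(7.10)` CLAIM. "the proof of Proposition 7.1 is reduced to showing that **`i𝒯₁₁(p) =
(p/α)(½S₁(𝐚₁,𝐚₂) + 2S₂(𝐚₁,𝐚₂) + 3/2 S₃(𝐚₁,𝐚₂)) + O(P𝓛² Σ_{1≤j≤3}|S_j(𝐚₁,𝐚₂)|) + o(P)`** for `p ∼ P`"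
(tex L1972–L1979; proved in part (c), tex L2063–L2178), `S_j = Skeleton.Sj`, `𝐚₁, 𝐚₂` satisfying
(7.2). [cite: Zhang2022LandauSiegel, §7 (7.10) p. 37, tex L1973] -/
def Eq710 : Prop :=
  ∀ B : ℝ, ∀ ε : ℝ, 0 < ε → ∃ C : ℝ, Skeleton.ForAllLarge fun D _ χ => Skeleton.AssumptionA D χ →
    ∀ a₁ a₂ : ℕ → ℂ, Skeleton.Adm72 D B a₁ → Skeleton.Adm72 D B a₂ →
      ∀ p ∈ Skeleton.primeWindow D,
        ‖I * frakT11 c' D p a₁ a₂ -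
            (p : ℂ) / (Skeleton.alpha D : ℂ) *
              (1 / 2 * Skeleton.Sj c' D 1 a₁ a₂ + 2 * Skeleton.Sj c' D 2 a₁ a₂ +
                3 / 2 * Skeleton.Sj c' D 3 a₁ a₂)‖
          ≤ C * (Skeleton.bigP D * Skeleton.ell D ^ 2 *
                (‖Skeleton.Sj c' D 1 a₁ a₂‖ + ‖Skeleton.Sj c' D 2 a₁ a₂‖ + ‖Skeleton.Sj c' D 3 a₁ a₂‖)) +
            ε * Skeleton.bigP D

/-- `Z22:(7.11)` CLAIM. "and **`Σ_{p∼P} p^{β₃} 𝒯₁₂(p) = o(𝔓)`**" (tex L1979–L1982; proved in part (b),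
"The error term", tex L1984–L2058), `𝐚₁, 𝐚₂` satisfying (7.2).
[cite: Zhang2022LandauSiegel, §7 (7.11) p. 37, tex L1980] -/
def Eq711 : Prop :=
  ∀ B : ℝ, ∀ ε : ℝ, 0 < ε → Skeleton.ForAllLarge fun D _ χ => Skeleton.AssumptionA D χ →
    ∀ a₁ a₂ : ℕ → ℂ, Skeleton.Adm72 D B a₁ → Skeleton.Adm72 D B a₂ →
      ‖∑ p ∈ Skeleton.primeWindow D, (p : ℂ) ^ Skeleton.beta3 c' D * frakT12 c' D p a₁ a₂‖
        ≤ ε * frakP D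

/-- (tex L1972; no DAG id) CLAIM(proof). "**By (7.6) and (7.9), the proof of Proposition 7.1 is
reduced to showing** (7.10) for `p ∼ P`, and (7.11)" (with the note `(pt₀)^{β₃} = −1 + O(α₁)`):
the deduction `(7.6) → (7.9) → [(pt₀)^{β₃} = −1 + O(α₁)] → (7.10) → (7.11) → Proposition 7.1`, as ONE
named implication over this file's claims, closing in the banked `Skeleton.Prop71 c′`. Refines
`Skeleton.Ded71` (its last step; parts (b), (c) of the proof supply `Eq711`, `Eq710`).
[cite: Zhang2022LandauSiegel, §7 p. 37, tex L1972] -/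
def DedProp71red : Prop :=
  Eq76 c' → Eq79 c' → Step7t1972 c' → Eq710 c' → Eq711 c' → Skeleton.Prop71 c'

end Claims

end Literature.NumberTheory.LFunctions.Zhang2022.Section7bStatements
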